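import Summits.NavierStokesRegularity.NavierStokesRegularity.Theorems.SoloRefuteSiche2026Frame
import HarnessLib

/-!
# C135 `Siche2026` — the typed shell coherence `χ_K(x)` of a single streamwise mode

For the parallel-shear mode `v(x) = Re (α e^{2πi n x₀}) ŷ` (`n > 0`, `α ∈ ℂ`, `α ≠ 0`) on the unit torus,
in the paper's gauge (39): `ê₁(±n e₀) = ±ŷ`, `ê₂ = ẑ`, the helical coordinates are
`c^σ_{n e₀} = α/(2√2)`, `c^σ_{-n e₀} = -ᾱ/(2√2)` (both sectors), every other mode is silent, and
`m_{n²}(x) = i·Im(α e^{2πinx₀})/|α|`, `χ_{n²}(x) = N_{n²} · Im(α e^{2πinx₀})² / |α|²`, `χ_K(x) = 0`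
for `K ≠ n²`.

WHAT THIS IS NOT: not a claim about NS regularity or blow-up; not a claim about any author beyond the
typed locator.
-/

set_option linter.dupNamespace false

noncomputable section

open Literature.Analysis.FunctionSpaces Literature.Analysis.FunctionSpaces.Torus
open Literature.Claims.NS.Siche2026
open UnitAddTorus (mFourier mFourierCoeff)
open scoped ComplexConjugate

namespace Summit.NavierStokesRegularity.NavierStokesRegularity.Theorems.Siche2026

/-! ## Shells -/

/-- `k_i² ≤ |k|²`. [folklore] -/
theorem sq_le_latticeNormSq (k : Z3) (i : Fin 3) : k i ^ 2 ≤ latticeNormSq k := by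
  unfold latticeNormSq
  rw [Fin.sum_univ_three]
  fin_cases i <;> simp <;> nlinarith [sq_nonneg (k 0), sq_nonneg (k 1), sq_nonneg (k 2)]

/-- membership in the typed shell is the norm condition (the bounding box is automatic). -/
theorem mem_shell {K : ℕ} {k : Z3} : k ∈ shell K ↔ latticeNormSq k = K := by
  unfold shell
  rw [Finset.mem_filter, Fintype.mem_piFinset]
  constructor
  · exact fun h => h.2
  · intro h
    refine ⟨fun i => Finset.mem_Icc.2 ?_, h⟩
    have hi := sq_le_latticeNormSq k i
    rw [h] at hi
    constructor <;> nlinarith [sq_nonneg (k i - 1), sq_nonneg (k i + 1)]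

/-- `n e₀ ∈ S_{n²}`. [folklore] -/
theorem kx_mem_shell (n : ℤ) : kx n ∈ shell (n ^ 2).toNat := by
  rw [mem_shell, latticeNormSq_kx, Int.toNat_of_nonneg (sq_nonneg n)]

/-- `-n e₀ ∈ S_{n²}`. [folklore] -/
theorem neg_kx_mem_shell (n : ℤ) : -kx n ∈ shell (n ^ 2).toNat := by
  rw [neg_kx, mem_shell, latticeNormSq_kx, Int.toNat_of_nonneg (sq_nonneg n)]; ring

/-- the shell `S_{n²}` is nonempty. [folklore] -/
theorem shell_sq_nonempty (n : ℤ) : shell (n ^ 2).toNat ≠ ∅ :=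
  Finset.ne_empty_of_mem (kx_mem_shell n)

/-- `#S_{n²} ≥ 2` for `n ≠ 0`. [folklore] -/
theorem two_le_card_shell_sq {n : ℤ} (hn : n ≠ 0) : 2 ≤ (shell (n ^ 2).toNat).card := by
  have h : ({kx n, -kx n} : Finset Z3) ⊆ shell (n ^ 2).toNat := by
    intro k hk
    simp only [Finset.mem_insert, Finset.mem_singleton] at hk
    rcases hk with rfl | rfl
    · exact kx_mem_shell n
    · exact neg_kx_mem_shell n
  calc 2 = ({kx n, -kx n} : Finset Z3).card := by rw [Finset.card_pair (kx_ne_neg hn)]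
    _ ≤ _ := Finset.card_le_card h

/-- `N_{n²} > 0` for `n ≠ 0`. [folklore] -/
theorem shellModes_pos {n : ℤ} (hn : n ≠ 0) : 0 < shellModes (n ^ 2).toNat := by
  unfold shellModes; have := two_le_card_shell_sq hn; omega

/-- a sum over a shell of a function supported on `{n e₀, -n e₀}`. -/
theorem sum_shell_eq {n : ℤ} (hn : n ≠ 0) {K : ℕ} (g : Z3 → ℂ)
    (hg : ∀ k, k ≠ kx n → k ≠ -kx n → g k = 0) :
    ∑ k ∈ shell K, g k = (if kx n ∈ shell K then g (kx n) else 0) +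
      (if -kx n ∈ shell K then g (-kx n) else 0) := by
  classical
  have key : ∀ k ∈ shell K, g k = (if k = kx n then g (kx n) else 0) + (if k = -kx n then g (-kx n) else 0) := by
    intro k _
    by_cases h1 : k = kx n
    · subst h1; rw [if_pos rfl, if_neg (kx_ne_neg hn), add_zero]
    · by_cases h2 : k = -kx n
      · subst h2; rw [if_neg h1, if_pos rfl, zero_add]
      · rw [if_neg h1, if_neg h2, add_zero, hg k h1 h2]
  rw [Finset.sum_congr rfl key, Finset.sum_add_distrib, Finset.sum_ite_eq', Finset.sum_ite_eq']

/-- the real version -/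
theorem sum_shell_eq_real {n : ℤ} (hn : n ≠ 0) {K : ℕ} (g : Z3 → ℝ)
    (hg : ∀ k, k ≠ kx n → k ≠ -kx n → g k = 0) :
    ∑ k ∈ shell K, g k = (if kx n ∈ shell K then g (kx n) else 0) +
      (if -kx n ∈ shell K then g (-kx n) else 0) := by
  classical
  have key : ∀ k ∈ shell K, g k = (if k = kx n then g (kx n) else 0) + (if k = -kx n then g (-kx n) else 0) := by
    intro k _
    by_cases h1 : k = kx n
    · subst h1; rw [if_pos rfl, if_neg (kx_ne_neg hn), add_zero]
    · by_cases h2 : k = -kx n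
      · subst h2; rw [if_neg h1, if_pos rfl, zero_add]
      · rw [if_neg h1, if_neg h2, add_zero, hg k h1 h2]
  rw [Finset.sum_congr rfl key, Finset.sum_add_distrib, Finset.sum_ite_eq', Finset.sum_ite_eq']

/-- both `±n e₀` lie on the shell `K` or neither does. -/
theorem neg_kx_mem_shell_iff (n : ℤ) (K : ℕ) : -kx n ∈ shell K ↔ kx n ∈ shell K := by
  rw [mem_shell, mem_shell, neg_kx, latticeNormSq_kx, latticeNormSq_kx, neg_sq]

/-! ## Mean amplitude, magnetisation and coherence of the mode -/

/-- **the mean amplitude of the mode**: `ā_K = √2 |α| / N_K` on the active shell, `0` elsewhere. [cite: Siche2026, Definition 4.1 p. 7] -/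
theorem meanAmp_mode {n : ℤ} (hn : 0 < n) (α : ℂ) (K : ℕ) :
    meanAmp (shearMode n α) K =
      (shellModes K : ℝ)⁻¹ * (if kx n ∈ shell K then Real.sqrt 2 * ‖α‖ else 0) := by
  unfold meanAmp
  congr 1
  rw [sum_shell_eq_real hn.ne']
  · by_cases h : kx n ∈ shell K
    · rw [if_pos h, if_pos ((neg_kx_mem_shell_iff n K).2 h), if_pos h,
        helCoeff_mode_pos hn α true, helCoeff_mode_pos hn α false, helCoeff_mode_neg hn α true,
        helCoeff_mode_neg hn α false]
      simp only [norm_neg, norm_div, Complex.norm_conj, Complex.norm_mul, Complex.norm_real,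
        Complex.norm_ofNat, Real.norm_of_nonneg (Real.sqrt_nonneg 2)]
      have h2 : Real.sqrt 2 ≠ 0 := by positivity
      have hs : Real.sqrt 2 ^ 2 = 2 := Real.sq_sqrt (by norm_num)
      field_simp
      rw [hs]; ring
    · rw [if_neg h, if_neg (fun h' => h ((neg_kx_mem_shell_iff n K).1 h')), if_neg h, add_zero]
  · intro k h1 h2
    rw [helCoeff_mode_eq_zero hn.ne' α h1 h2, helCoeff_mode_eq_zero hn.ne' α h1 h2, norm_zero, add_zero]

/-- the shell sum in `m_K(x)`: `(α e − ᾱ ē)/√2` on the active shell, `0` elsewhere. -/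
theorem sum_magnetization_mode {n : ℤ} (hn : 0 < n) (α : ℂ) (K : ℕ) (x : T3) :
    ∑ k ∈ shell K, mFourier k x * (helCoeff (shearMode n α) k true + helCoeff (shearMode n α) k false) =
      if kx n ∈ shell K then
        (mFourier (kx n) x * α - conj (mFourier (kx n) x * α)) / Real.sqrt 2 else 0 := by
  rw [sum_shell_eq hn.ne']
  · by_cases h : kx n ∈ shell K
    · rw [if_pos h, if_pos ((neg_kx_mem_shell_iff n K).2 h), if_pos h,
        helCoeff_mode_pos hn α true, helCoeff_mode_pos hn α false, helCoeff_mode_neg hn α true,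
        helCoeff_mode_neg hn α false, UnitAddTorus.mFourier_neg, map_mul]
      have h2 : (Real.sqrt 2 : ℂ) ≠ 0 := by exact_mod_cast (show Real.sqrt 2 ≠ 0 by positivity)
      field_simp
      ring
    · rw [if_neg h, if_neg (fun h' => h ((neg_kx_mem_shell_iff n K).1 h')), if_neg h, add_zero]
  · intro k h1 h2
    rw [helCoeff_mode_eq_zero hn.ne' α h1 h2, helCoeff_mode_eq_zero hn.ne' α h1 h2, add_zero, mul_zero]

/-- `z - conj z = 2i·Im z` -/
theorem sub_conj_eq (z : ℂ) : z - conj z = 2 * Complex.I * (z.im : ℂ) := by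
  apply Complex.ext <;> simp; ring

/-- **the magnetisation of the mode**: `m_K(x) = i·Im(α e_{n e₀}(x))/|α|` on the active shell `K = n²`
(`α ≠ 0`), `0` on every other shell. -/
theorem magnetization_mode {n : ℤ} (hn : 0 < n) {α : ℂ} (hα : α ≠ 0) (K : ℕ) (x : T3) :
    magnetization (shearMode n α) K x =
      if kx n ∈ shell K then Complex.I * ((mFourier (kx n) x * α).im : ℂ) / (‖α‖ : ℂ) else 0 := by
  unfold magnetization
  rw [sum_magnetization_mode hn, meanAmp_mode hn]
  split_ifs with h
  · have hN : (shellModes K : ℂ) ≠ 0 := by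
      have : 0 < shellModes K := by
        unfold shellModes
        have : 0 < (shell K).card := Finset.card_pos.2 ⟨_, h⟩
        omega
      exact_mod_cast this.ne'
    have h2 : (Real.sqrt 2 : ℂ) ≠ 0 := by exact_mod_cast (show Real.sqrt 2 ≠ 0 by positivity)
    have hα' : (‖α‖ : ℂ) ≠ 0 := by exact_mod_cast (norm_ne_zero_iff.2 hα)
    have h22 : (Real.sqrt 2 : ℂ) ^ 2 = 2 := by
      rw [← Complex.ofReal_pow, Real.sq_sqrt (by norm_num : (0:ℝ) ≤ 2)]; norm_num
    rw [sub_conj_eq]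
    push_cast
    field_simp
    rw [h22]
  · simp

/-- `|m_K(x)| = |Im(α e_{n e₀}(x))| / |α|` on the active shell, `0` elsewhere. [cite: Siche2026, Definition 4.1 p. 7] -/
theorem norm_magnetization_mode {n : ℤ} (hn : 0 < n) {α : ℂ} (hα : α ≠ 0) (K : ℕ) (x : T3) :
    ‖magnetization (shearMode n α) K x‖ =
      if kx n ∈ shell K then |(mFourier (kx n) x * α).im| / ‖α‖ else 0 := by
  rw [magnetization_mode hn hα]
  split_ifs
  · rw [norm_div, norm_mul, Complex.norm_I, one_mul, Complex.norm_real, Complex.norm_real,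
      Real.norm_eq_abs, Real.norm_of_nonneg (norm_nonneg α)]
  · exact norm_zero

/-- **the coherence of the mode**: `χ_K(x) = N_K · Im(α e_{n e₀}(x))² / |α|²` on the active shell,
`0` elsewhere. -/
theorem coherence_mode {n : ℤ} (hn : 0 < n) {α : ℂ} (hα : α ≠ 0) (K : ℕ) (x : T3) :
    coherence (shearMode n α) K x =
      if kx n ∈ shell K then (shellModes K : ℝ) * ((mFourier (kx n) x * α).im ^ 2 / ‖α‖ ^ 2) else 0 := by
  unfold coherence
  rw [norm_magnetization_mode hn hα]
  split_ifs
  · rw [div_pow, sq_abs]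
  · simp

/-- the active shell is `K = n²`. -/
theorem kx_mem_shell_iff {n : ℤ} {K : ℕ} : kx n ∈ shell K ↔ (K : ℤ) = n ^ 2 := by
  rw [mem_shell, latticeNormSq_kx]; constructor <;> intro h <;> exact h.symm

/-- **at `x = 0`**: `χ_{n²}(0) = N_{n²} · (Im α)²/|α|²` — `= N_{n²}` for the SINE profile `α = -i A`. -/
theorem coherence_mode_zero {n : ℤ} (hn : 0 < n) {α : ℂ} (hα : α ≠ 0) :
    coherence (shearMode n α) (n ^ 2).toNat 0 = (shellModes (n ^ 2).toNat : ℝ) * (α.im ^ 2 / ‖α‖ ^ 2) := by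
  rw [coherence_mode hn hα, if_pos (kx_mem_shell n)]
  simp [UnitAddTorus.mFourier]

/-- **the SINE profile is fully coherent at `x = 0`**: `χ_{n²}(0) = N_{n²}` for `v = A sin(2πnx₀) ŷ`. [cite: Siche2026, Definition 4.1 p. 7 («For fully coherent (aligned) phases, χ_K = N_K»)] -/
theorem coherence_mode_sine {n : ℤ} (hn : 0 < n) {A : ℝ} (hA : A ≠ 0) :
    coherence (shearMode n (-(Complex.I * A))) (n ^ 2).toNat 0 = shellModes (n ^ 2).toNat := by
  have hα : (-(Complex.I * A) : ℂ) ≠ 0 := by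
    simp [hA]
  rw [coherence_mode_zero hn hα]
  have : ((-(Complex.I * (A : ℂ))).im) ^ 2 / ‖-(Complex.I * (A : ℂ))‖ ^ 2 = 1 := by
    simp only [Complex.neg_im, Complex.mul_im, Complex.I_re, Complex.ofReal_im, mul_zero,
      Complex.I_im, Complex.ofReal_re, one_mul, zero_add, norm_neg, norm_mul, Complex.norm_I,
      Complex.norm_real, Real.norm_eq_abs, neg_sq, sq_abs]
    exact div_self (pow_ne_zero 2 hA)
  rw [this, mul_one]

/-- **on the active shell, at `x = 0`**: `χ_K(0) = N_K · (Im α)²/|α|²` whenever `n e₀ ∈ S_K`. -/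
theorem coherence_shearMode_zero_of_mem {n : ℤ} (hn : 0 < n) {α : ℂ} (hα : α ≠ 0) {K : ℕ}
    (hK : kx n ∈ shell K) :
    coherence (shearMode n α) K 0 = (shellModes K : ℝ) * (α.im ^ 2 / ‖α‖ ^ 2) := by
  rw [coherence_mode hn hα, if_pos hK]
  simp [UnitAddTorus.mFourier]

/-- `|m_K(0)| = |Im α| / |α|` on the active shell. -/
theorem norm_magnetization_shearMode_zero_of_mem {n : ℤ} (hn : 0 < n) {α : ℂ} (hα : α ≠ 0) {K : ℕ}
    (hK : kx n ∈ shell K) : ‖magnetization (shearMode n α) K 0‖ = |α.im| / ‖α‖ := by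
  rw [norm_magnetization_mode hn hα, if_pos hK]
  simp [UnitAddTorus.mFourier]

/-- a positive real multiple of `-i` (the decayed SINE profile): `|Im α| / |α| = 1`. -/
theorem abs_im_div_norm_of_sine {r : ℝ} (hr : 0 < r) :
    |((r : ℂ) * -Complex.I).im| / ‖(r : ℂ) * -Complex.I‖ = 1 := by
  have h1 : ((r : ℂ) * -Complex.I).im = -r := by simp
  have h2 : ‖(r : ℂ) * -Complex.I‖ = r := by
    rw [norm_mul, norm_neg, Complex.norm_I, mul_one, Complex.norm_real, Real.norm_of_nonneg hr.le]
  rw [h1, h2, abs_neg, abs_of_pos hr, div_self hr.ne']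

/-- **silent shells**: a shell not containing `n e₀` has `χ_K ≡ 0` for the mode. -/
theorem coherence_shearMode_of_not_mem {n : ℤ} (hn : 0 < n) {α : ℂ} (hα : α ≠ 0) {K : ℕ}
    (hK : kx n ∉ shell K) (x : T3) : coherence (shearMode n α) K x = 0 := by
  rw [coherence_mode hn hα, if_neg hK]


end Summit.NavierStokesRegularity.NavierStokesRegularity.Theorems.Siche2026
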